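import Mathlib.Analysis.SpecialFunctions.Pow.Real
import HarnessLib

/-!
# The tangent inequality R23 along an edge as star-shapedness of the pencil cubic (Sahi programme, prover prim-sahi-p2 gen 39)

Support file (`--supports stmt-CriticalPhenomena-4575`).  No definitions, no named facts, no sorries; standard axioms.
Memo `run/shared/lean/prim/prim-sahi/FROM-prim-sahi-p2-gen39-PER-FIBRE-TANGENT.md` §0(1)(iv), addendum (A1); `prim-sahi-p2/PROOF-E3.md` §49.

Along one pair `e` of a finite weighted graph, with the other weights fixed, Sahi's `E₃` of the three cluster events is a real cubic
`E(p) = A₀ + A₁p + A₂p² + A₃p³` in the weight `p` of `e`, whose leading coefficient `A₃ = δ_iδ_jδ_k` is nonnegative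
(`EdgeInduction`, gen 4/5) and whose constant term is `E₃` of the deleted graph.  Gen 32's R23 — `3c₂ ≥ 2c₃` for the Bernstein
coefficients, i.e. `E(1) ≥ E′(1)` — reads `A₀ ≥ A₂ + 2A₃` in monomial form.  This file records the elementary real-algebra facts used
in gen 39's reformulation:

* `cubic_starShaped_iff` — for `A₃ ≥ 0`:  `(∀ p ∈ [0,1], p·E′(p) ≤ E(p)) ↔ (0 ≤ A₀ ∧ A₂ + 2A₃ ≤ A₀)`; i.e. R23 together with
  `E(0) ≥ 0` says exactly that `p ↦ E(p)/p` is non-increasing on `(0,1]` ("`E₃` is star-shaped from the origin along the edge");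
* `cubic_chord_of_starShaped` — then `E(p) ≥ p·E(1)` on `[0,1]` (the chord consequence used by the any-pair schema);
* `perFibre_one_of_two` — the per-fibre reduction (A1): `A₀ ≥ A₂ + 2A₃`, `0 ≤ A₀`, `0 ≤ A₃` give `2A₀ ≥ A₂ + A₃` (PF1 from PF2);
* `bernstein_chord_of_slices` — in Bernstein form `E(p) = w₀(1-p)³ + 3w₁p(1-p)² + 3w₂p²(1-p) + w₃p³`, the slice inequalities
  `w₀ ≥ 0`, `3w₁ ≥ w₃`, `3w₂ ≥ 2w₃` (PF1, PF2 of the memo) give `E(p) ≥ p·w₃` coefficientwise.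

Nothing here is specific to percolation; nothing asserts R23 or PF.
-/

noncomputable section

namespace Summit.CriticalPhenomena.PercolationContinuityZ3.Theorems

namespace IncStar

/-- **R23 ∧ `E(0) ≥ 0` ⟺ star-shapedness.**  For a real cubic `E(p) = A₀ + A₁p + A₂p² + A₃p³` with `A₃ ≥ 0`:
`p·E′(p) ≤ E(p)` for all `p ∈ [0,1]` iff `0 ≤ A₀` and `A₂ + 2A₃ ≤ A₀`.  (`⇒`: take `p = 0, 1`; `⇐`: `A₂p² + 2A₃p³ ≤ max 0 (A₂ + 2A₃)`.) [this work] -/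
theorem cubic_starShaped_iff (A₀ A₁ A₂ A₃ : ℝ) (h₃ : 0 ≤ A₃) :
    (∀ p : ℝ, 0 ≤ p → p ≤ 1 →
        p * (A₁ + 2 * A₂ * p + 3 * A₃ * p ^ 2) ≤ A₀ + A₁ * p + A₂ * p ^ 2 + A₃ * p ^ 3) ↔
      (0 ≤ A₀ ∧ A₂ + 2 * A₃ ≤ A₀) := by
  constructor
  · intro h
    refine ⟨?_, ?_⟩
    · have := h 0 le_rfl zero_le_one
      simpa using this
    · have := h 1 zero_le_one le_rfl
      nlinarith [this]
  · rintro ⟨h0, h1⟩ p hp0 hp1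
    -- need A₂ p² + 2 A₃ p³ ≤ A₀
    have hp2 : p ^ 2 ≤ 1 := by nlinarith
    have hp3 : p ^ 3 ≤ p ^ 2 := by nlinarith [pow_nonneg hp0 2]
    by_cases hA : 0 ≤ A₂
    · nlinarith [mul_nonneg hA (pow_nonneg hp0 2), mul_nonneg h₃ (pow_nonneg hp0 3), pow_nonneg hp0 2, pow_nonneg hp0 3]
    · push Not at hA
      -- A₂ p² + 2A₃ p³ = p² (A₂ + 2 A₃ p) ≤ p² · max 0 (A₂ + 2A₃) ≤ max 0 (A₂+2A₃) ≤ A₀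
      have hq : A₂ + 2 * A₃ * p ≤ A₂ + 2 * A₃ := by nlinarith
      by_cases hB : A₂ + 2 * A₃ ≤ 0
      · have : A₂ * p ^ 2 + 2 * A₃ * p ^ 3 ≤ 0 := by
          have : A₂ * p ^ 2 + 2 * A₃ * p ^ 3 = p ^ 2 * (A₂ + 2 * A₃ * p) := by ring
          rw [this]
          exact mul_nonpos_iff.mpr (Or.inl ⟨pow_nonneg hp0 2, by linarith⟩)
        nlinarith [pow_nonneg hp0 2, pow_nonneg hp0 3]
      · push Not at hB
        have : A₂ * p ^ 2 + 2 * A₃ * p ^ 3 ≤ A₂ + 2 * A₃ := by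
          have e : A₂ * p ^ 2 + 2 * A₃ * p ^ 3 = p ^ 2 * (A₂ + 2 * A₃ * p) := by ring
          rw [e]
          calc p ^ 2 * (A₂ + 2 * A₃ * p) ≤ p ^ 2 * (A₂ + 2 * A₃) :=
                mul_le_mul_of_nonneg_left hq (pow_nonneg hp0 2)
            _ ≤ 1 * (A₂ + 2 * A₃) := mul_le_mul_of_nonneg_right hp2 hB.le
            _ = A₂ + 2 * A₃ := one_mul _
        nlinarith [pow_nonneg hp0 2, pow_nonneg hp0 3]

/-- **Chord from star-shape.**  If `p·E′(p) ≤ E(p)` on `[0,1]` (equivalently R23 ∧ `E(0) ≥ 0`, by `cubic_starShaped_iff`) and `A₃ ≥ 0`,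
then `E(p) ≥ p·E(1)` on `[0,1]`. [this work] -/
theorem cubic_chord_of_starShaped (A₀ A₁ A₂ A₃ : ℝ) (h₃ : 0 ≤ A₃) (h0 : 0 ≤ A₀) (h1 : A₂ + 2 * A₃ ≤ A₀)
    (p : ℝ) (hp0 : 0 ≤ p) (hp1 : p ≤ 1) :
    p * (A₀ + A₁ + A₂ + A₃) ≤ A₀ + A₁ * p + A₂ * p ^ 2 + A₃ * p ^ 3 := by
  -- E(p) - pE(1) = (1-p)·[A₀ - p(A₂ + A₃(1+p))] and A₂ + A₃(1+p) ≤ A₂ + 2A₃ ≤ A₀ when ... handle signs with nlinarith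
  have h1p : 0 ≤ 1 - p := by linarith
  have key : A₀ + A₁ * p + A₂ * p ^ 2 + A₃ * p ^ 3 - p * (A₀ + A₁ + A₂ + A₃)
      = (1 - p) * (A₀ - p * A₂ - p * (1 + p) * A₃) := by ring
  have inner : 0 ≤ A₀ - p * A₂ - p * (1 + p) * A₃ := by
    by_cases hA : 0 ≤ A₂
    · nlinarith [mul_nonneg hp0 hA, mul_nonneg hp0 h₃]
    · push Not at hA
      nlinarith [mul_nonneg h1p h₃, mul_nonneg hp0 h₃, mul_nonneg (mul_nonneg hp0 hp0) h₃]
  nlinarith [mul_nonneg h1p inner, key]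

/-- **PF1 from PF2 (memo addendum (A1)).**  In monomial form, `A₀ ≥ A₂ + 2A₃` (PF2 / R23 per fibre), `0 ≤ A₀` and `0 ≤ A₃` give
`2A₀ ≥ A₂ + A₃` (PF1 per fibre). [this work] -/
theorem perFibre_one_of_two (A₀ A₂ A₃ : ℝ) (h2 : A₂ + 2 * A₃ ≤ A₀) (h0 : 0 ≤ A₀) (h3 : 0 ≤ A₃) :
    A₂ + A₃ ≤ 2 * A₀ := by linarith

/-- **Coefficientwise chord from the slice inequalities.**  If the Bernstein coefficients of the cubic
`E(p) = w₀(1-p)³ + 3w₁p(1-p)² + 3w₂p²(1-p) + w₃p³` satisfy `0 ≤ w₀`, `w₃ ≤ 3w₁`, `2w₃ ≤ 3w₂` (the per-fibre relations PF1, PF2 of the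
memo, with `w₀ ≥ 0`), then `E(p) ≥ p·w₃ = p·E(1)` on `[0,1]` — each Bernstein coefficient of `E(p) − p·E(1)` is nonnegative. [this work] -/
theorem bernstein_chord_of_slices (w₀ w₁ w₂ w₃ p : ℝ) (hw₀ : 0 ≤ w₀) (hw₁ : w₃ ≤ 3 * w₁) (hw₂ : 2 * w₃ ≤ 3 * w₂)
    (hp0 : 0 ≤ p) (hp1 : p ≤ 1) :
    p * w₃ ≤ w₀ * (1 - p) ^ 3 + 3 * w₁ * p * (1 - p) ^ 2 + 3 * w₂ * p ^ 2 * (1 - p) + w₃ * p ^ 3 := by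
  have h1p : 0 ≤ 1 - p := by linarith
  -- p = p(1-p)² + 2p²(1-p) + p³  (the Bernstein expansion of p), compare coefficientwise
  have e : p * w₃ = (w₃ / 3) * (3 * p * (1 - p) ^ 2) + (2 * w₃ / 3) * (3 * p ^ 2 * (1 - p)) + w₃ * p ^ 3 := by ring
  rw [e]
  have b0 : 0 ≤ (1 - p) ^ 3 := pow_nonneg h1p 3
  have b1 : 0 ≤ 3 * p * (1 - p) ^ 2 := by positivity
  have b2 : 0 ≤ 3 * p ^ 2 * (1 - p) := by
    have := mul_nonneg (mul_nonneg (by norm_num : (0:ℝ) ≤ 3) (pow_nonneg hp0 2)) h1p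
    simpa using this
  nlinarith [mul_nonneg hw₀ b0, mul_le_mul_of_nonneg_right (show w₃ / 3 ≤ w₁ by linarith) b1,
    mul_le_mul_of_nonneg_right (show 2 * w₃ / 3 ≤ w₂ by linarith) b2]

end IncStar

end Summit.CriticalPhenomena.PercolationContinuityZ3.Theorems

end
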